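import Mathlib
import Summits.Ventures.PercRepro2.CoinTreeCore
import Summits.Ventures.PercRepro2.CoinOrTailKDefs
import Summits.Ventures.PercRepro2.CoinKSureCoins
import Summits.Ventures.PercRepro2.CoinKSureTransport

/-!
# The three-entry instance on a TIGHT vertex set (blind cell PercRepro2, night-2 g15;
NIGHT2-DARC.md §50)

The 15-coin instance of `CoinKSureExample` (s = 0, m₁ = 1, m₂ = 2, r₁ = 3, r₂ = 4, r₃ = 5,
a = 6, w = 7, t = 8) on `Fin 9` — the vertex set has NO spare vertex, so the cardinality bound
`ent.card + (U ∪ {a, w}).card = 3 + 7 = 10 ≤ 9` of `darc_of_orTailTreeK_coins_card` FAILS and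
the virtual labelling of `darc_of_orTailTreeK_coins` does not exist; `darc_of_orTailTreeK_coins_any`
(the transport along `V ↪ V ⊕ V`) gives row 2′DARC at `a → w` for the markers `m₁, m₂` and
EVERY probability vector nonetheless (`darc_kCoins_example9`).
-/

namespace Summit.Ventures.PercRepro2.Coin

namespace KSureExample9

open Classical

/-- The fifteen coins of the example on `Fin 9`. -/
def arcsEx9 : Fin 15 → Finset (Fin 9 × Fin 9)
  | 0 => {(0, 1)}   -- s → m₁
  | 1 => {(0, 2)}   -- s → m₂
  | 2 => {(0, 3)}   -- s → r₁
  | 3 => {(0, 4)}   -- s → r₂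
  | 4 => {(0, 5)}   -- s → r₃
  | 5 => {(3, 6)}   -- r₁ → a
  | 6 => {(4, 6)}   -- r₂ → a
  | 7 => {(5, 6)}   -- r₃ → a
  | 8 => {(6, 8)}   -- a → t
  | 9 => {(7, 8)}   -- w → t
  | 10 => {(3, 8)}  -- r₁ → t
  | 11 => {(4, 7)}  -- r₂ → w
  | 12 => {(5, 7)}  -- r₃ → w
  | 13 => {(1, 7)}  -- m₁ → w
  | 14 => {(2, 7)}  -- m₂ → w

/-- The entry coins: `c r₁ = 5`, `c r₂ = 6`, `c r₃ = 7`. -/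
def cEx9 : Fin 9 → Fin 15
  | 3 => 5
  | 4 => 6
  | 5 => 7
  | _ => 0

/-- The tree coins. -/
def tcEx9 : Fin 9 → Fin 15
  | 1 => 0
  | 2 => 1
  | 3 => 2
  | 4 => 3
  | 5 => 4
  | _ => 0

/-- The parent map (every core vertex is a child of `s`). -/
def parEx9 : Fin 9 → Fin 9 := fun _ => 0

/-- The rank. -/
def rkEx9 : Fin 9 → ℕ
  | 1 => 1
  | 2 => 1
  | 3 => 1
  | 4 => 1
  | 5 => 1
  | _ => 0

/-- Every coin is a single arc, so `SameEnds` holds. -/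
lemma sameEnds_ex9 : SameEnds arcsEx9 := by
  intro e xy hxy x'y' hx'y'
  fin_cases e <;> simp [arcsEx9] at hxy hx'y' <;> subst hxy <;> subst hx'y' <;>
    exact ⟨Or.inl rfl, Or.inr rfl⟩

set_option maxRecDepth 20000 in
/-- `{m₁, m₂, r₁, r₂, r₃}` is an out-tree core of `s`. -/
lemma treeCore_ex9 : TreeCore arcsEx9 0 {1, 2, 3, 4, 5} tcEx9 parEx9 rkEx9 where
  tree := by decide
  par_mem := by decide
  rank := by decide
  into_C := by decide
  into_s := by decide
  s_notin := by decide

set_option maxRecDepth 20000 in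
/-- The core with the tail `a = 6` entered from `r₁, r₂, r₃` is a three-entry OR-tail. -/
lemma orTailK_ex9 : OrTailK arcsEx9 0 {1, 2, 3, 4, 5} {3, 4, 5} cEx9 6 where
  ent_sub := by decide
  s_notin := by decide
  a_notin := by decide
  a_ne_s := by decide
  into_U := by decide
  into_s := by decide
  into_a := by decide
  arcs_c := by decide
  c_inj := by decide

/-- The cardinality bound of `darc_of_orTailTreeK_coins_card` fails on `Fin 9`: there is no
room for three virtual vertices. -/
lemma no_room_ex9 :
    ¬ (({3, 4, 5} : Finset (Fin 9)).card +
        (({1, 2, 3, 4, 5} : Finset (Fin 9)) ∪ {6, 7}).card ≤ Fintype.card (Fin 9)) := by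
  decide

/-- **Row 2′DARC at the arc `a → w` for the markers `m₁, m₂` on the TIGHT vertex set `Fin 9`,
three uncovered entries with tail coins of ANY probability, the markers' own arcs into the
head, EVERY probability vector — no hypothesis at all.** -/
theorem darc_kCoins_example9 {R : Type*} [Field R] [LinearOrder R] [IsStrictOrderedRing R]
    (pr : Fin 15 → R) (hp : IsProbVec pr) :
    DARC pr arcsEx9 0 {8} 1 2 6 7 :=
  darc_of_orTailTreeK_coins_any pr hp sameEnds_ex9 orTailK_ex9 treeCore_ex9 (by decide)
    (by decide) (by decide) (by decide) (by decide) (by decide)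

end KSureExample9

end Summit.Ventures.PercRepro2.Coin
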